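import Summits.HodgeConjecture.HodgeConjecture.Theorems.Ring2AbelianAllAndreTwistedSquareEven
import HarnessLib

/-!
# Ring 2 · AbelianAll — ANDRÉ AXIS, PART Q-a: TWO WEIGHTS ON `T = P × E` — the `K`-symmetrised classes
  `pr_P^*h_{P,K} + s·pr_E^*η_K` of an even-dimensional `T` with a `K`-stable elliptic factor have discriminant classes `[s]·δ₀`
  (abelian-variety level; the input of part Q-b's EVEN NON-SPLIT anchors `E₀^{2j+2} × Ē₀^{2j+2}`)

HONEST FRAMING (sub-cell `pub-hodge-ring2-ab-*`, verbatim): research route, not a corollary; conditional on HC_CM plus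
one named minimal statement. (Cell `pub-hodge-ring2`, verbatim: research route conditional on HC_CM; not a corollary;
Q11.4-sentence-2 already refuted in dim ≥ 3.) `HC_CM`, `HC_AV` and the global nodes do NOT occur in this file. No definition,
no named fact, no `sorry`; ABELIAN-VARIETY level (no pencil); the only inputs are tree theorems. Seat `pub-hodge-ring2-ab-andre-2`,
gen 47 (part Q).

CONTEXT AND THE POINT. Parts O–P (gens 45–46) computed the van Geemen class of the twisted square `(T × T, φ × (−φ))`
polarized by `L ⊠ L^{⊗m}` (ONE polarization `L` of `T` on both factors): `[(−m)^g]`, `g = dim T` — every negative class for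
`g` odd (the non-split W₆ anchors `B × B̄`, `E³ × Ē³`), but ONLY the trivial class for `g` even, whence part P's sentence «the
André method of part O has no even-dimensional analogue with product classes». Parts Q-a/Q-b REFINE that sentence: with TWO
polarizations `L₁ = h_P ⊞ η`, `L_m = h_P ⊞ mη` of ONE even-dimensional `T = P × E` (`P` any abelian variety of ODD dimension
`2j+1` with `φ_P² = −d`, `E` an elliptic curve with `ψ² = −d`, diagonal structure `φ_T = φ_P × ψ`) the product class `L₁ ⊠ L_m`
on `(T × T, φ_T × (−φ_T))` has class `disc(L₁)·disc(L_m) = [m]` — EVERY POSITIVE CLASS (part Q-b). This file supplies the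
two-weight discriminants of `T` itself.

* §1 `exists_kFrame_ksymm_curve` / `exists_kFrame_ksymm_all` — the `K`-frame of van Geemen Lemma 5.2 (2)–(3) with its Gram
  determinant and top coefficient in dimension `1` (from the tree's rational model of the CM curve: frame `(v)`, `a = (1)`,
  `b = (0)`, `det Ψ = 1`), hence in EVERY dimension `m + 1 ≥ 1` (ab-weil-2's `exists_kFrame_ksymm` is `m ≥ 1`).
* §2 `exists_projectiveEmbedding_weight` — Segre powers re-weight an embedding: `f^*g = s·f₀^*g` (Hartshorne II Ex. 5.11–5.12).
* §3 `exists_nat_mk_eq_of_pos` — every POSITIVE class of `ℚˣ/Nm(K_dˣ)` is `[m]`, `m ∈ ℕ`; **`exists_hasWeilDiscriminantNondeg_prodCurve_weights`**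
  — for `T = P × E` as above and the embeddings `e_s` of `T` with `e_s^*g = pr_P^*(e_P^*g) + s·pr_E^*(f₀^*g)` (`s ≥ 1`): the
  `K`-symmetrised class `d·e_s^*g + φ_T^*e_s^*g = pr_P^*h_{P,K} + s·pr_E^*η_K` carries a NON-DEGENERATE discriminant witness of class
  **`[s]·δ₀`** for ONE `δ₀` independent of `s`, and has non-zero top power («`det H` multiplicative» in the product frame of
  ab-weil-2's `hasWeilDiscriminantNondeg_prod_of_kFrames`, ranks `2j+1` and `1`: the weight enters as `s^{2j+1} ≡ s` — through
  the ODD rank of `P`; this is why `T` needs a `K`-stable elliptic factor, and why ONE polarization (part P-a) sees only `1`).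

HONEST REMARKS. Nothing here is a case of the Hodge conjecture; nothing minimal is claimed; N104 untouched. «`det H` multiplicative»
is printed (one sentence, no proof) only in Markman's unrefereed survey; the carriers' proof is ab-weil-2's, reused by name.

## References

* [vanGeemen1994HodgeAV] B. van Geemen, LNM 1594 (1994), 4.9, 4.14, Lemma 5.2 (1)–(3), 5.3.
* [Markman2025SurveySecant] E. Markman, arXiv:2509.23403 (unrefereed), §11.5 Step 2 («det H multiplicative», one sentence).
* [Hartshorne1977] R. Hartshorne, Algebraic Geometry (1977), II Ex. 5.11–5.12. [MumfordAV1970] D. Mumford, §6 Appl. 1.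
* [LangeBirkenhake1992] H. Lange, Ch. Birkenhake (1992), Lemma 1.1.17 and §5.3.
* [MoonenZarhin1999LowDim] B. Moonen, Yu. Zarhin, Math. Ann. 315 (1999), Thm. 0.1 (a) (product polarizations `aL ⊠ bL'`).
-/

set_option linter.dupNamespace false

noncomputable section

open CategoryTheory MonoidalCategory AlgebraicGeometry CartesianMonoidalCategory
open Literature.AlgebraicGeometry Literature.AlgebraicGeometry.Motives
open Literature.AlgebraicGeometry.Motives.SegreHyperplaneClass
open Literature.AlgebraicGeometry.HodgeTheory Literature.AlgebraicGeometry.VanGeemen1994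
open Literature.AlgebraicTopology.SingularHomology
open Literature.Geometry.Kaehler

namespace Summit.HodgeConjecture.HodgeConjecture.Ring2.AbelianAll

/-! ## §1 The `K`-frame in dimension one, hence in every dimension -/

section Frames

variable {A : AbelianVariety ℂ} {m d : ℕ} {φ : A ⟶ A}

/-- **The `K`-frame of van Geemen Lemma 5.2 (2)–(3) for an elliptic curve** (`dim A = 1`, `φ ≫ φ = −d`, `d ≥ 1`): in the
rational frame `x = (v)` of `K`-rank one (`(v, φ^*v)` a basis of `H¹`, the tree's `cmCurve_rationalModel`), with the top class
`ω = v ∪ φ^*v`, the Gram data of `Q_{h,0}(x, y) = x ∪ y` are `a = (1)`, `b = (0)` — `det Ψ = 1` —, and `h_K = L⁰ h_K = t·ω`.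
[cite: vanGeemen1994HodgeAV, 4.9 and Lemma 5.2 (2)–(3)] [cite: LangeBirkenhake1992, Lemma 1.1.17] -/
theorem exists_kFrame_ksymm_curve (hA : A.dim = 0 + 1) (hd : 0 < d) (hφ : φ ≫ φ = -(d • 𝟙 A))
    (e : ProjectiveEmbedding A.X) {a : complexBetti (projectiveSpace e.n ℂ) 2} (ha : IsRationalClass a) :
    ∃ (x : Fin (0 + 1) → complexBetti A.X 1) (ω : complexBetti A.X (2 + 2 * 0))
      (am bm : Matrix (Fin (0 + 1)) (Fin (0 + 1)) ℚ) (q : ℚˣ) (t : ℚ),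
      (∀ i, IsRationalClass (x i)) ∧
      LinearIndependent ℂ (Sum.elim x (fun i => complexBetti.map φ.hom.hom.hom 1 (x i))) ∧
      IsRationalClass ω ∧ ω ≠ 0 ∧
      (∀ i j, polarizationPairingOne A.X
          ((d : ℂ) • complexBetti.map e.ι 2 a + complexBetti.map φ.hom.hom.hom 2 (complexBetti.map e.ι 2 a)) 0
          (x i) (complexBetti.map φ.hom.hom.hom 1 (x j)) = ((am i j : ℚ) : ℂ) • ω ∧
        polarizationPairingOne A.X
          ((d : ℂ) • complexBetti.map e.ι 2 a + complexBetti.map φ.hom.hom.hom 2 (complexBetti.map e.ι 2 a)) 0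
          (x i) (x j) = ((bm i j : ℚ) : ℂ) • ω) ∧
      (weilGramMatrix d am bm).det = algebraMap ℚ (weilField d) (q : ℚ) ∧
      lefschetzPow ((d : ℂ) • complexBetti.map e.ι 2 a + complexBetti.map φ.hom.hom.hom 2 (complexBetti.map e.ι 2 a)) 0 2
        ((d : ℂ) • complexBetti.map e.ι 2 a + complexBetti.map φ.hom.hom.hom 2 (complexBetti.map e.ι 2 a)) =
        ((t : ℚ) : ℂ) • ω := by
  classical
  obtain ⟨u, ωE, hur, hli, -, hMu, -, hωEr, hωE0, hG, hT, -, -⟩ := cmCurve_rationalModel hA hd hφ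
  have hu0 : complexBetti.map φ.hom.hom.hom 1 (u 0) = u 1 := by
    rw [hMu 0]; simp [Fin.sum_univ_two]
  obtain ⟨t, ht⟩ := hT _ (isRationalClass_ksymm d φ e ha)
  refine ⟨fun _ => u 0, ωE, !![(1 : ℚ)], !![(0 : ℚ)], 1, t, fun _ => hur 0, ?_, hωEr, hωE0, ?_, ?_, ht⟩
  · -- `(u₀ | φ^* u₀) = (u₀ | u₁)` is independent
    have h := hli.comp (finSumFinEquiv : Fin 1 ⊕ Fin 1 ≃ Fin 2) (finSumFinEquiv : Fin 1 ⊕ Fin 1 ≃ Fin 2).injective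
    convert h using 1
    funext y
    rcases y with i | i
    · fin_cases i
      rfl
    · fin_cases i
      show complexBetti.map φ.hom.hom.hom 1 (u 0) = u ((finSumFinEquiv : Fin 1 ⊕ Fin 1 ≃ Fin 2) (Sum.inr 0))
      rw [hu0]
      rfl
  · intro i j
    fin_cases i; fin_cases j
    refine ⟨?_, ?_⟩
    · show polarizationPairingOne A.X _ 0 (u 0) (complexBetti.map φ.hom.hom.hom 1 (u 0)) = _
      rw [hu0, hG _ 0 1]; simp
    · show polarizationPairingOne A.X _ 0 (u 0) (u 0) = _
      rw [hG _ 0 0]; simp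
  · simp [weilGramMatrix_apply]

/-- **The `K`-frame with Gram determinant and top coefficient in EVERY dimension `m + 1 ≥ 1`** (the tree's
`exists_kFrame_ksymm` for `m ≥ 1`, §1 for `m = 0`). [cite: vanGeemen1994HodgeAV, Lemma 5.2 (1)–(3) and 5.3] -/
theorem exists_kFrame_ksymm_all (hA : A.dim = m + 1) (hd : 0 < d) (hφ : φ ≫ φ = -(d • 𝟙 A))
    (e : ProjectiveEmbedding A.X) {a : complexBetti (projectiveSpace e.n ℂ) 2} (ha : IsRationalClass a) (ha0 : a ≠ 0) :
    ∃ (x : Fin (m + 1) → complexBetti A.X 1) (ω : complexBetti A.X (2 + 2 * m))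
      (am bm : Matrix (Fin (m + 1)) (Fin (m + 1)) ℚ) (q : ℚˣ) (t : ℚ),
      (∀ i, IsRationalClass (x i)) ∧
      LinearIndependent ℂ (Sum.elim x (fun i => complexBetti.map φ.hom.hom.hom 1 (x i))) ∧
      IsRationalClass ω ∧ ω ≠ 0 ∧
      (∀ i j, polarizationPairingOne A.X
          ((d : ℂ) • complexBetti.map e.ι 2 a + complexBetti.map φ.hom.hom.hom 2 (complexBetti.map e.ι 2 a)) m
          (x i) (complexBetti.map φ.hom.hom.hom 1 (x j)) = ((am i j : ℚ) : ℂ) • ω ∧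
        polarizationPairingOne A.X
          ((d : ℂ) • complexBetti.map e.ι 2 a + complexBetti.map φ.hom.hom.hom 2 (complexBetti.map e.ι 2 a)) m
          (x i) (x j) = ((bm i j : ℚ) : ℂ) • ω) ∧
      (weilGramMatrix d am bm).det = algebraMap ℚ (weilField d) (q : ℚ) ∧
      lefschetzPow ((d : ℂ) • complexBetti.map e.ι 2 a + complexBetti.map φ.hom.hom.hom 2 (complexBetti.map e.ι 2 a)) m 2
        ((d : ℂ) • complexBetti.map e.ι 2 a + complexBetti.map φ.hom.hom.hom 2 (complexBetti.map e.ι 2 a)) =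
        ((t : ℚ) : ℂ) • ω := by
  cases m with
  | zero => exact exists_kFrame_ksymm_curve hA hd hφ e ha
  | succ m => exact exists_kFrame_ksymm (by omega) hA hd hφ e ha ha0

end Frames

/-! ## §2 Re-weighting a projective embedding by Segre powers -/

section Weight

/-- **`f^*g = s·f₀^*g`**: the `(s−1)`-st Segre power of a projective embedding `f₀` is a projective embedding with `s` times
the hyperplane class, for every Segre-additive family `g` (Hartshorne II Ex. 5.11–5.12, `𝒪(s)`).
[cite: Hartshorne1977, II Ex. 5.11 and Ex. 5.12] [cite: MumfordAV1970, §6 Application 1] -/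
theorem exists_projectiveEmbedding_weight (g : (N : ℕ) → complexBetti (projectiveSpace N ℂ) 2)
    (hgσ : ∀ n m : ℕ, complexBetti.map (segreEmbedding n m ℂ) 2 (g (n * m + n + m)) =
      complexBetti.map (CartesianMonoidalCategory.fst (projectiveSpace n ℂ) (projectiveSpace m ℂ)) 2 (g n) +
        complexBetti.map (CartesianMonoidalCategory.snd (projectiveSpace n ℂ) (projectiveSpace m ℂ)) 2 (g m))
    {X : SchemeOver ℂ} (f₀ : ProjectiveEmbedding X) {s : ℕ} (hs : 0 < s) :
    ∃ f : ProjectiveEmbedding X, f₀.n ≤ f.n ∧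
      complexBetti.map f.ι 2 (g f.n) = ((s : ℕ) : ℂ) • complexBetti.map f₀.ι 2 (g f₀.n) := by
  obtain ⟨d₁, rfl⟩ : ∃ k, s = k + 1 := ⟨s - 1, by omega⟩
  haveI := isClosedImmersion_segrePow_left f₀.n d₁
  have hci : IsClosedImmersion (f₀.ι ≫ ProjectiveSpace.segrePow f₀.n ℂ d₁).left := by
    change IsClosedImmersion (f₀.ι.left ≫ (ProjectiveSpace.segrePow f₀.n ℂ d₁).left)
    infer_instance
  have hMle : ∀ k, f₀.n ≤ ProjectiveSpace.segrePowDim f₀.n k := by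
    intro k
    cases k with
    | zero => exact le_rfl
    | succ k => exact Nat.le_add_left _ _
  refine ⟨⟨_, f₀.ι ≫ ProjectiveSpace.segrePow f₀.n ℂ d₁, hci⟩, hMle d₁, ?_⟩
  change complexBetti.map (f₀.ι ≫ ProjectiveSpace.segrePow f₀.n ℂ d₁) 2 (g (ProjectiveSpace.segrePowDim f₀.n d₁)) = _
  rw [map_comp_apply', map_segrePow_of_additive g hgσ f₀.n d₁, map_smul]

end Weight

/-! ## §3 `T = P × E`: the weight-`s` classes `pr_P^*h_{P,K} + s·pr_E^*η_K` have discriminant classes `[s]·δ₀` -/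

section ProdCurve

variable {P E : AbelianVariety ℂ} {φP : P ⟶ P} {ψ : E ⟶ E} {j d : ℕ}

/-- Every class of POSITIVE sign in `ℚˣ/Nm(K_dˣ)` is `[m]` for a positive integer `m` (`q = N/D > 0`, `m = N·D`,
`[q] = [−1]·[−q] = [−1]·[−m] = [m]`, part O-a's `exists_nat_mk_neg_eq`). [cite: vanGeemen1994HodgeAV, 4.14] -/
theorem exists_nat_mk_eq_of_pos {d : ℕ} (q : ℚˣ) (hq : 0 < (q : ℚ)) :
    ∃ (m : ℕ) (hm : 0 < m),
      (QuotientGroup.mk (Units.mk0 (m : ℚ) (Nat.cast_ne_zero.2 hm.ne')) : weilNormResidueGroup d) = QuotientGroup.mk q := by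
  have hq' : ((-q : ℚˣ) : ℚ) < 0 := by rw [Units.val_neg]; exact neg_lt_zero.2 hq
  obtain ⟨m, hm, hmq⟩ := exists_nat_mk_neg_eq (d := d) (-q) hq'
  refine ⟨m, hm, ?_⟩
  have e1 : Units.mk0 (m : ℚ) (Nat.cast_ne_zero.2 hm.ne') = (-1) * -Units.mk0 (m : ℚ) (Nat.cast_ne_zero.2 hm.ne') := by
    rw [neg_mul_neg, one_mul]
  have e2 : q = (-1) * -q := by rw [neg_mul_neg, one_mul]
  rw [e1, e2, QuotientGroup.mk_mul, QuotientGroup.mk_mul, hmq]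

/-- **THE TWO-WEIGHT DISCRIMINANTS OF `T = P × E`.** Let `P` be a complex abelian variety of ODD dimension `2j + 1` with
`φ_P ≫ φ_P = −(d • 𝟙 P)`, `E` an elliptic curve with `ψ ≫ ψ = −(d • 𝟙 E)` (`d ≥ 1`), `φ_T = φ_P × ψ` the diagonal structure on
`T = P × E` (`K`-rank `2j + 2`), `e_P`, `f₀` projective embeddings and `g` a Segre-additive rational family of hyperplane classes,
`h_{P,K} = d·e_P^*g + φ_P^*e_P^*g`, `η_K = d·f₀^*g + ψ^*f₀^*g`. There is ONE class `δ₀ ∈ ℚˣ/Nm(K_dˣ)` such that for EVERY weight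
`s ≥ 1` some projective embedding `e_s` of `T` (Segre of `e_P` with the `(s−1)`-st Segre power of `f₀`) has `K`-symmetrised class
`d·e_s^*g + φ_T^*e_s^*g = pr_P^*h_{P,K} + s·pr_E^*η_K` carrying a NON-DEGENERATE discriminant witness of class **`[s]·δ₀`** and having
non-zero top power: in the product frame (ranks `2j+1`, `1`; ab-weil-2's `hasWeilDiscriminantNondeg_prod_of_kFrames`) the class is
`[(C₁·s t₀)^{2j+1} (C₂ t) · q_P q_E] = [s]·[(C₁t₀)^{2j+1} C₂ t q_P q_E]` since `s^{2j+1} = s·(s^j)²`. The weight enters through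
the ODD rank of `P`: this is why `T` must have a `K`-stable elliptic factor. [cite: vanGeemen1994HodgeAV, Lemma 5.2 (2)–(3), 4.14 and 5.3]
[cite: Markman2025SurveySecant, §11.5 Step 2] [cite: Hartshorne1977, II Ex. 5.11 and Ex. 5.12] -/
theorem exists_hasWeilDiscriminantNondeg_prodCurve_weights
    (g : (N : ℕ) → complexBetti (projectiveSpace N ℂ) 2) (hgr : ∀ N : ℕ, IsRationalClass (g N))
    (hgnz : ∀ N : ℕ, 1 ≤ N → g N ≠ 0)
    (hgσ : ∀ n m : ℕ, complexBetti.map (segreEmbedding n m ℂ) 2 (g (n * m + n + m)) =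
      complexBetti.map (CartesianMonoidalCategory.fst (projectiveSpace n ℂ) (projectiveSpace m ℂ)) 2 (g n) +
        complexBetti.map (CartesianMonoidalCategory.snd (projectiveSpace n ℂ) (projectiveSpace m ℂ)) 2 (g m))
    (hP : P.dim = 2 * j + 1) (hE : E.dim = 0 + 1) (hd : 0 < d) (hφP : φP ≫ φP = -(d • 𝟙 P))
    (hψ : ψ ≫ ψ = -(d • 𝟙 E)) (eP : ProjectiveEmbedding P.X) (hP1 : 1 ≤ eP.n) (f₀ : ProjectiveEmbedding E.X)
    (hE1 : 1 ≤ f₀.n) :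
    ∃ δ₀ : weilNormResidueGroup d, ∀ (s : ℕ) (hs : 0 < s),
      ∃ e : ProjectiveEmbedding (P.prod E).X, 1 ≤ e.n ∧
        (d : ℂ) • complexBetti.map e.ι 2 (g e.n) +
            complexBetti.map (AbelianVariety.prodLift (AbelianVariety.fst P E ≫ φP)
              (AbelianVariety.snd P E ≫ ψ)).hom.hom.hom 2 (complexBetti.map e.ι 2 (g e.n)) =
          complexBetti.map (AbelianVariety.fst P E).hom.hom.hom 2
              ((d : ℂ) • complexBetti.map eP.ι 2 (g eP.n) + complexBetti.map φP.hom.hom.hom 2 (complexBetti.map eP.ι 2 (g eP.n))) +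
            complexBetti.map (AbelianVariety.snd P E).hom.hom.hom 2
              ((((s : ℚ)) : ℂ) •
                ((d : ℂ) • complexBetti.map f₀.ι 2 (g f₀.n) + complexBetti.map ψ.hom.hom.hom 2 (complexBetti.map f₀.ι 2 (g f₀.n)))) ∧
        HasWeilDiscriminantNondeg (P.prod E)
            (AbelianVariety.prodLift (AbelianVariety.fst P E ≫ φP) (AbelianVariety.snd P E ≫ ψ)) (j + 1) d
            ((d : ℂ) • complexBetti.map e.ι 2 (g e.n) +
              complexBetti.map (AbelianVariety.prodLift (AbelianVariety.fst P E ≫ φP)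
                (AbelianVariety.snd P E ≫ ψ)).hom.hom.hom 2 (complexBetti.map e.ι 2 (g e.n)))
            (QuotientGroup.mk (Units.mk0 (s : ℚ) (Nat.cast_ne_zero.2 hs.ne')) * δ₀) ∧
        lefschetzPow ((d : ℂ) • complexBetti.map e.ι 2 (g e.n) +
              complexBetti.map (AbelianVariety.prodLift (AbelianVariety.fst P E ≫ φP)
                (AbelianVariety.snd P E ≫ ψ)).hom.hom.hom 2 (complexBetti.map e.ι 2 (g e.n))) (2 * (j + 1) - 1) 2
            ((d : ℂ) • complexBetti.map e.ι 2 (g e.n) +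
              complexBetti.map (AbelianVariety.prodLift (AbelianVariety.fst P E ≫ φP)
                (AbelianVariety.snd P E ≫ ψ)).hom.hom.hom 2 (complexBetti.map e.ι 2 (g e.n))) ≠ 0 := by
  classical
  set Φ := AbelianVariety.prodLift (AbelianVariety.fst P E ≫ φP) (AbelianVariety.snd P E ≫ ψ) with hΦ
  set hPK := (d : ℂ) • complexBetti.map eP.ι 2 (g eP.n) + complexBetti.map φP.hom.hom.hom 2 (complexBetti.map eP.ι 2 (g eP.n))
    with hPKdef
  set ηK := (d : ℂ) • complexBetti.map f₀.ι 2 (g f₀.n) + complexBetti.map ψ.hom.hom.hom 2 (complexBetti.map f₀.ι 2 (g f₀.n))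
    with hηKdef
  have hX : IsSmoothProjective (2 * j + 1) P.X := isSmoothProjective_of_dim_eq' hP
  have hY : IsSmoothProjective (0 + 1) E.X := isSmoothProjective_of_dim_eq' hE
  have hN : 2 * (j + 1) = 2 * j + 0 + 2 := by ring
  -- (1) the `K`-frames of `(P, φ_P, h_{P,K})` (rank `2j+1`) and of `(E, ψ, η_K)` (rank `1`)
  obtain ⟨x, ω, am, bm, q, t, hx, hi, hω, hω0, hp, hq, ht⟩ :=
    exists_kFrame_ksymm_all (m := 2 * j) hP hd hφP eP (hgr _) (hgnz _ hP1)
  obtain ⟨y, ω₀, a₀, b₀, q₀, t₀, hy, hiy, hω₀, hω₀0, hp₀, hq₀, ht₀⟩ := exists_kFrame_ksymm_curve hE hd hψ f₀ (hgr _)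
  -- (2) the weight-`s` embeddings `e_s` and their `K`-symmetrised classes
  have hemb : ∀ s : ℕ, 0 < s → ∃ e : ProjectiveEmbedding (P.prod E).X, 1 ≤ e.n ∧
      complexBetti.map e.ι 2 (g e.n) =
        complexBetti.map (AbelianVariety.fst P E).hom.hom.hom 2 (complexBetti.map eP.ι 2 (g eP.n)) +
          complexBetti.map (AbelianVariety.snd P E).hom.hom.hom 2 (((s : ℕ) : ℂ) • complexBetti.map f₀.ι 2 (g f₀.n)) := by
    intro s hs
    obtain ⟨f, hfn, hf⟩ := exists_projectiveEmbedding_weight g hgσ f₀ hs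
    obtain ⟨e, hen, he⟩ := exists_projectiveEmbedding_prod g hgσ eP f
    exact ⟨e, le_trans hE1 (hfn.trans hen), by rw [he, hf]⟩
  have hKs : ∀ (s : ℕ) (e : ProjectiveEmbedding (P.prod E).X),
      complexBetti.map e.ι 2 (g e.n) =
        complexBetti.map (AbelianVariety.fst P E).hom.hom.hom 2 (complexBetti.map eP.ι 2 (g eP.n)) +
          complexBetti.map (AbelianVariety.snd P E).hom.hom.hom 2 (((s : ℕ) : ℂ) • complexBetti.map f₀.ι 2 (g f₀.n)) →
      (d : ℂ) • complexBetti.map e.ι 2 (g e.n) + complexBetti.map Φ.hom.hom.hom 2 (complexBetti.map e.ι 2 (g e.n)) =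
        complexBetti.map (AbelianVariety.fst P E).hom.hom.hom 2 hPK +
          complexBetti.map (AbelianVariety.snd P E).hom.hom.hom 2 ((((s : ℚ)) : ℂ) • ηK) := by
    intro s e he
    have hsc : (((s : ℚ)) : ℂ) = ((s : ℕ) : ℂ) := Rat.cast_natCast s
    rw [he, hΦ, smul_add_map_prodLift φP ψ (d : ℂ), hsc, map_smul, smul_comm (d : ℂ) ((s : ℕ) : ℂ), ← smul_add]
  -- (3) the frame data of `(E, ψ, s·η_K)`: Gram data unchanged (`Q_{h,0}` does not see `h`), top coefficient `s·t₀`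
  have hp₀' : ∀ (s : ℕ) (i k : Fin (0 + 1)),
      polarizationPairingOne E.X ((((s : ℚ)) : ℂ) • ηK) 0 (y i) (complexBetti.map ψ.hom.hom.hom 1 (y k)) =
          ((a₀ i k : ℚ) : ℂ) • ω₀ ∧
        polarizationPairingOne E.X ((((s : ℚ)) : ℂ) • ηK) 0 (y i) (y k) = ((b₀ i k : ℚ) : ℂ) • ω₀ := by
    intro s i k
    rw [polarizationPairingOne_smul, polarizationPairingOne_smul, pow_zero, one_smul, one_smul]
    exact hp₀ i k
  have ht₀' : ∀ s : ℕ, lefschetzPow ((((s : ℚ)) : ℂ) • ηK) 0 2 ((((s : ℚ)) : ℂ) • ηK) =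
      ((((s : ℚ) * t₀ : ℚ)) : ℂ) • ω₀ := by
    intro s
    rw [HodgeRiemannDegreeOne.lefschetzPow_smul_self, ht₀, smul_smul, zero_add, pow_one, ← Rat.cast_mul]
  -- (4) `t ≠ 0`, `t₀ ≠ 0` (the classes are `K`-symmetrised hyperplane classes of `T`; weight `1`)
  obtain ⟨e₁, he₁n, he₁⟩ := hemb 1 one_pos
  obtain ⟨ht0, ht₀0⟩ := prod_kFrames_top_ne_zero hP hE hN (kA := 2 * j + 1) (kB := 0 + 1) (by omega) (by omega)
    (by omega) hd hφP hψ x hx hi hPK ω am bm hp t ht y hy hiy _ ω₀ a₀ b₀ (hp₀' 1) (((1 : ℕ) : ℚ) * t₀) (ht₀' 1)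
    e₁ (hgr _) (hgnz _ he₁n) (hKs 1 e₁ he₁)
  have ht₀0' : t₀ ≠ 0 := by simpa using ht₀0
  -- (5) the reference class `δ₀ = [(C₁ t₀)^{2j+1} (C₂ t) q_P q_E]`
  have hC₁0 : (((2 * (j + 1) - 1).choose (2 * j) : ℕ) : ℚ) ≠ 0 := Nat.cast_ne_zero.2 (Nat.choose_pos (by omega)).ne'
  have hC₂0 : (((2 * (j + 1) - 1).choose (2 * j + 1) : ℕ) : ℚ) ≠ 0 :=
    Nat.cast_ne_zero.2 (Nat.choose_pos (by omega)).ne'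
  have hU₁0 : ((((2 * (j + 1) - 1).choose (2 * j) : ℕ) : ℚ) * t₀) ^ (2 * j + 1) *
      ((((2 * (j + 1) - 1).choose (2 * j + 1) : ℕ) : ℚ) * t) ^ (0 + 1) ≠ 0 :=
    mul_ne_zero (pow_ne_zero _ (mul_ne_zero hC₁0 ht₀0')) (pow_ne_zero _ (mul_ne_zero hC₂0 ht0))
  refine ⟨QuotientGroup.mk (Units.mk0 _ hU₁0 * q * q₀), fun s hs ↦ ?_⟩
  have hsQ : (s : ℚ) ≠ 0 := Nat.cast_ne_zero.2 hs.ne'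
  have hst₀0 : (s : ℚ) * t₀ ≠ 0 := mul_ne_zero hsQ ht₀0'
  obtain ⟨e, hen, he⟩ := hemb s hs
  have hh := hKs s e he
  -- (6) the product witness in the frame `(pr_P^* x, pr_E^* y)`
  let ε : Fin (2 * j + 1) ⊕ Fin (0 + 1) ≃ Fin (2 * (j + 1)) := finSumFinEquiv.trans (finCongr (by omega))
  have hδ := hasWeilDiscriminantNondeg_prod_of_kFrames hP hE hN ε x hx hi hPK ω hω hω0 am bm hp t ht ht0 q hq
    y hy hiy ((((s : ℚ)) : ℂ) • ηK) ω₀ hω₀ hω₀0 a₀ b₀ (hp₀' s) ((s : ℚ) * t₀) (ht₀' s) hst₀0 q₀ hq₀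
  rw [← hh] at hδ
  refine ⟨e, hen, hh, ?_, ?_⟩
  · -- `[(C₁ s t₀)^{2j+1} (C₂ t) q_P q_E] = [s]·δ₀`
    convert hδ using 2
    rw [← QuotientGroup.mk_mul]
    refine (weilNormResidueGroup_mk_eq_mk_of_val_eq (Units.mk0 (s : ℚ) hsQ ^ j) ?_).symm
    simp only [Units.val_mul, Units.val_mk0, Units.val_pow_eq_pow_val]
    ring
  · -- the top power `C(2j+2, 2j+1)·t·(s t₀) · pr_P^*ω ∪ pr_E^*ω₀ ≠ 0`
    rw [hh, lefschetzPow_add_map_self hP hE (show 2 * (j + 1) - 1 = 2 * j + 0 + 1 by omega) hPK ω t ht _ ω₀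
      ((s : ℚ) * t₀) (ht₀' s)]
    refine smul_ne_zero ?_ (cupProduct_map_fst_map_snd_ne_zero_of_add_eq hX hY _ (by omega) hω0 hω₀0)
    exact_mod_cast mul_ne_zero (mul_ne_zero (Nat.cast_ne_zero.2 (Nat.choose_pos (by omega)).ne') ht0) hst₀0

end ProdCurve

end Summit.HodgeConjecture.HodgeConjecture.Ring2.AbelianAll

end
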